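import Mathlib
import Literature.Barriers.ValiantsHypothesis.AlgebraicNaturalProofs
import Literature.Computability.AlgebraicComplexity.ArithCircuitProofs
import Literature.Computability.AlgebraicComplexity.IMMInVPProofs
import Summits.ValiantsHypothesis.ValiantsHypothesis.Theorems.BarrierLeverPartitionMinorsHitByVPTwinFreeLift
import Summits.ValiantsHypothesis.ValiantsHypothesis.Theorems.BarrierLeverPartitionMinorsHitByVPTwinMatchingEngine

/-!
# Route BarrierLever — item `PartitionMinorsHitByVP` (stmt-ValiantsHypothesis-19717):
# the TWIN-MATCHING CONTRACTION DOOR, part 2/2: the coefficient identity and the door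

Helper file (`--supports stmt-ValiantsHypothesis-19717`; cell valiant-natproofs, rung V4, 𝒟-side,
prover seat val-np-p3 gen 3). Definition-free. Closes NO item.

Contract one coordinate pair `(a, c)`: row `U` goes to `U.erase a`, column `W` to `W.erase c`.
Two rows with the same contraction form an `a`-TWIN PAIR `{U, U ∪ {a}}`; the other rows are
singletons of their class. The twin-free lift of `…TwinFreeLift` (val-np-p6; the counterpart of the
TT reduction R2) handles the case of NO twins on either side. This file handles EQUAL TWIN COUNTS:
if the number of `a`-twin pairs among the rows equals the number of `c`-twin pairs among the
columns, and ONE polynomial `g` certifies both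
* the CLASS layout `L♭` (one representative row per row class — the bottom `U ∌ a` when present —
  against one representative column per column class), and
* the TWIN layout `L^tw` (the twin-top rows `U ∋ a` whose bottom is a row, against the twin-top
  columns),
then `f = g₀ · ((1 + x_a)(1 + y_c) + μ · x_a y_c)` (`g₀` = `g` with the monomials containing `x_a`
or `y_c` removed) certifies `(u, w)` for all but finitely many `μ`, at cost `L(f) ≤ L(g) + 7`,
`deg f ≤ deg g + 2`. PROOF: the layout matrix of `f` is `N_μ[i,j] = M[ρ i, ρ' j] · (1 + μ·[a ∈ u i]
[c ∈ w j])` with `M` the contracted matrix of `g`; after the unimodular operations «twin-top row −=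
its bottom row», «twin-top column −= its bottom column» it becomes
`[[M₁₁ + μE₁₁, μE₁₂], [μE₂₁, μM₂₂]]` in the block decomposition (representatives | twin tops), with
`M₁₁ = M[L♭]`, `M₂₂ = M[L^tw]`; so `det N_μ = μ^tw · q(μ)` with `q(0) = det M[L♭] · det M[L^tw] ≠ 0`
(`exists_det_fromBlocks_pert_ne_zero`, `exists_det_twinGadget_ne_zero`).

The index bookkeeping is supplied by the user as DATA: equivalences `erow ecol : κ₁ ⊕ κ₂ ≃ ι`
(representatives ⊕ twin tops) and the bottom maps `c₁ c₂ : κ₂ → κ₁`, with three hypotheses each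
(bottom avoids the coordinate, top contains it, equal contractions). No injectivity hypothesis is
needed (a bad choice of representatives only makes the hypotheses on `g` unsatisfiable). Taking
`κ₂` empty recovers the twin-free lift. In TNS / TT language (items 19126 / 19152) the same
computation with the `2 × 2` block `[[1, 1], [−μ, 1]] ⊕ K'` is a REDUCTION: a minimal
counterexample to `PrincipalMinorLayoutsNonsingular` has `tw_a(u) ≠ tw_c(w)` for all `a, c`.

* `exists_det_fromBlocks_pert_ne_zero` — `det [[M₁₁ + μE₁₁, μE₁₂], [E₂₁, M₂₂]] ≠ 0` for some
  `μ ≠ 0` when `det M₁₁ · det M₂₂ ≠ 0` (polynomial in `μ`, value at `0`).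
* `exists_det_twinGadget_ne_zero` — the matrix-level engine (any entry function, any index types).
* `coeff_twinGadget` — the layout matrix of `g₀ · ((1 + x_a)(1 + y_c) + μ x_a y_c)`.
* **`partitionMinor_hit_of_twinMatching`** — the door (degree-free bookkeeping; combine with
  `…StrataDoor.exists_smallCircuits_of_sized` to land in `SmallCircuits`).
* `exists_common_witness` — two certified layouts have a COMMON witness `g₁ + C t · g₂`
  (how the single `g` of the door is produced; cost additive).

WHAT THIS IS NOT: one reduction step; nothing on which layouts reduce to few good leaves (the
content of item 19717), on crux 14610 or on VP vs VNP.
-/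

set_option linter.dupNamespace false

namespace Summit.ValiantsHypothesis.ValiantsHypothesis.Theorems.BarrierLever.TwinMatching

open Finset Polynomial
open Literature.Barriers.ValiantsHypothesis Literature.Computability.AlgebraicComplexity
open Summit.ValiantsHypothesis.ValiantsHypothesis.Theorems.BarrierLever.ProductStateSums
  (castAdd_ne_natAdd partitionExpo_apply_castAdd partitionExpo_apply_natAdd)
open Summit.ValiantsHypothesis.ValiantsHypothesis.Theorems.BarrierLever.StrataDoor
  (coeff_killVars complexity_killVars_le totalDegree_killVars_le coeff_mul_one_add_X_of_free
    partitionExpo_erase_erase)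

/-! ## 3. The layout matrix of `g₀ · ((1 + x_a)(1 + y_c) + μ x_a y_c)` -/

variable {h : ℕ}

/-- Truncated subtraction of `single s 1` is erasure when the exponent of `s` is at most one. -/
theorem tsub_single_eq_erase {n : ℕ} (m : Fin n →₀ ℕ) (s : Fin n) (hm : m s ≤ 1) :
    m - Finsupp.single s 1 = m.erase s := by
  ext t
  rw [Finsupp.tsub_apply, Finsupp.erase_apply, Finsupp.single_apply]
  by_cases hts : s = t
  · subst hts; rw [if_pos rfl, if_pos rfl]; omega
  · rw [if_neg hts, if_neg (Ne.symm hts)]; omega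

/-- **The twin gadget reads off the contracted coefficients.** With `g₀` = the monomials of `g`
avoiding `x_a, y_c` and `G = (1 + x_a)(1 + y_c) + μ · x_a y_c`:
`coeff_{x^U y^W} (g₀ · G) = (1 + μ·[a ∈ U][c ∈ W]) · coeff_{x^{U∖a} y^{W∖c}} g`. -/
theorem coeff_twinGadget (a c : Fin h) (g : MvPolynomial (Fin (h + h)) ℂ) (μ : ℂ)
    (U W : Finset (Fin h)) :
    MvPolynomial.coeff (∑ a' ∈ U, Finsupp.single (Fin.castAdd h a') 1 +
        ∑ c' ∈ W, Finsupp.single (Fin.natAdd h c') 1)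
      ((∑ d ∈ g.support with (d (Fin.castAdd h a) = 0 ∧ d (Fin.natAdd h c) = 0),
          MvPolynomial.monomial d (MvPolynomial.coeff d g)) *
        ((1 + MvPolynomial.X (Fin.castAdd h a)) * (1 + MvPolynomial.X (Fin.natAdd h c)) +
          MvPolynomial.C μ * (MvPolynomial.X (Fin.castAdd h a) * MvPolynomial.X (Fin.natAdd h c)))) =
      (if a ∈ U ∧ c ∈ W then 1 + μ else 1) *
        MvPolynomial.coeff (∑ a' ∈ U.erase a, Finsupp.single (Fin.castAdd h a') 1 +
          ∑ c' ∈ W.erase c, Finsupp.single (Fin.natAdd h c') 1) g := by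
  classical
  set xa : Fin (h + h) := Fin.castAdd h a with hxa
  set yc : Fin (h + h) := Fin.natAdd h c with hyc
  set g₀ : MvPolynomial (Fin (h + h)) ℂ := ∑ d ∈ g.support with (d xa = 0 ∧ d yc = 0),
      MvPolynomial.monomial d (MvPolynomial.coeff d g) with hg₀
  set m : Fin (h + h) →₀ ℕ := ∑ a' ∈ U, Finsupp.single (Fin.castAdd h a') 1 +
      ∑ c' ∈ W, Finsupp.single (Fin.natAdd h c') 1 with hm
  have hg₀free : ∀ d ∈ g₀.support, d xa = 0 ∧ d yc = 0 := by
    intro d hd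
    have := MvPolynomial.mem_support_iff.mp hd
    rw [hg₀, coeff_killVars] at this
    by_contra hh
    exact this (if_neg hh)
  have hg₁free : ∀ d ∈ (g₀ * (1 + MvPolynomial.X xa)).support, d yc = 0 := by
    intro d hd
    have := MvPolynomial.mem_support_iff.mp hd
    by_contra hh
    apply this
    rw [mul_add, mul_one, MvPolynomial.coeff_add, MvPolynomial.coeff_mul_X']
    have h1 : MvPolynomial.coeff d g₀ = 0 := by
      rw [← MvPolynomial.notMem_support_iff]
      exact fun hd' => hh (hg₀free d hd').2
    have h2 : MvPolynomial.coeff (d - Finsupp.single xa 1) g₀ = 0 := by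
      rw [← MvPolynomial.notMem_support_iff]
      intro hd'
      have := (hg₀free _ hd').2
      rw [Finsupp.tsub_apply, Finsupp.single_apply, if_neg (castAdd_ne_natAdd a c)] at this
      exact hh (by simpa using this)
    rw [h1, h2, zero_add, ite_self]
  -- exponent facts
  have hmyc : m yc = if c ∈ W then 1 else 0 := by rw [hm, hyc, partitionExpo_apply_natAdd]
  have hmxa : m xa = if a ∈ U then 1 else 0 := by rw [hm, hxa, partitionExpo_apply_castAdd]
  have hm1 : m yc ≤ 1 := by rw [hmyc]; split_ifs <;> omega
  have hm2 : (m.erase yc) xa ≤ 1 := by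
    rw [Finsupp.erase_apply, if_neg (castAdd_ne_natAdd a c), hmxa]; split_ifs <;> omega
  have herase : (m.erase yc).erase xa = ∑ a' ∈ U.erase a, Finsupp.single (Fin.castAdd h a') 1 +
      ∑ c' ∈ W.erase c, Finsupp.single (Fin.natAdd h c') 1 := by
    rw [hm, hxa, hyc]; exact partitionExpo_erase_erase U W a c
  -- the part `g₀ (1 + x_a)(1 + y_c)`
  have hpart₁ : MvPolynomial.coeff m (g₀ * ((1 + MvPolynomial.X xa) * (1 + MvPolynomial.X yc))) =
      MvPolynomial.coeff (∑ a' ∈ U.erase a, Finsupp.single (Fin.castAdd h a') 1 +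
          ∑ c' ∈ W.erase c, Finsupp.single (Fin.natAdd h c') 1) g := by
    rw [← mul_assoc, coeff_mul_one_add_X_of_free yc _ hg₁free _ hm1,
      coeff_mul_one_add_X_of_free xa _ (fun d hd => (hg₀free d hd).1) _ hm2, herase, hg₀,
      coeff_killVars, if_pos]
    constructor
    · rw [partitionExpo_apply_castAdd, if_neg (Finset.notMem_erase a U)]
    · rw [partitionExpo_apply_natAdd, if_neg (Finset.notMem_erase c W)]
  -- the part `g₀ x_a y_c`
  have hpart₂ : MvPolynomial.coeff m (g₀ * (MvPolynomial.X xa * MvPolynomial.X yc)) =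
      if a ∈ U ∧ c ∈ W then MvPolynomial.coeff (∑ a' ∈ U.erase a, Finsupp.single (Fin.castAdd h a') 1 +
          ∑ c' ∈ W.erase c, Finsupp.single (Fin.natAdd h c') 1) g else 0 := by
    rw [← mul_assoc, MvPolynomial.coeff_mul_X']
    by_cases hcW : c ∈ W
    · have hycs : yc ∈ m.support := by
        rw [Finsupp.mem_support_iff, hmyc, if_pos hcW]; exact one_ne_zero
      rw [if_pos hycs, tsub_single_eq_erase m yc hm1, MvPolynomial.coeff_mul_X']
      by_cases haU : a ∈ U
      · have hxas : xa ∈ (m.erase yc).support := by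
          rw [Finsupp.mem_support_iff, Finsupp.erase_apply, if_neg (castAdd_ne_natAdd a c), hmxa,
            if_pos haU]
          exact one_ne_zero
        rw [if_pos hxas, tsub_single_eq_erase _ xa hm2, herase, hg₀, coeff_killVars, if_pos,
          if_pos ⟨haU, hcW⟩]
        constructor
        · rw [partitionExpo_apply_castAdd, if_neg (Finset.notMem_erase a U)]
        · rw [partitionExpo_apply_natAdd, if_neg (Finset.notMem_erase c W)]
      · have hxas : xa ∉ (m.erase yc).support := by
          rw [Finsupp.mem_support_iff, Finsupp.erase_apply, if_neg (castAdd_ne_natAdd a c), hmxa,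
            if_neg haU]
          exact fun hh => hh rfl
        rw [if_neg hxas, if_neg (fun hh => haU hh.1)]
    · have hycs : yc ∉ m.support := by
        rw [Finsupp.mem_support_iff, hmyc, if_neg hcW]; exact fun hh => hh rfl
      rw [if_neg hycs, if_neg (fun hh => hcW hh.2)]
  rw [mul_add, MvPolynomial.coeff_add, hpart₁, mul_left_comm, MvPolynomial.coeff_C_mul, hpart₂]
  split_ifs <;> ring

/-! ## 4. The twin-matching door -/

/-- **Twin-matching contraction door** (item 19717, 𝒟-side; generalises the twin-free lift).
Layout `(u, w)` on any index type `ι`; coordinate pair `(a, c)`. Data: `erow ecol : κ₁ ⊕ κ₂ ≃ ι`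
split the rows (columns) into REPRESENTATIVES `κ₁` and TWIN TOPS `κ₂`; the twin top `k` contains
`a` (`c`), its bottom `c₁ k` (`c₂ k`) is a representative avoiding `a` (`c`) with the same
contraction. If ONE polynomial `g` has nonsingular contracted layout matrices on representatives ×
representatives AND on twin tops × twin tops, then some `f` with `L(f) ≤ L(g) + 7`,
`deg f ≤ deg g + 2` has a nonsingular layout matrix on `(u, w)`. (For the `SmallCircuits` form
combine with `…StrataDoor.exists_smallCircuits_of_sized`; for the common `g` use
`exists_common_witness`.) -/
theorem partitionMinor_hit_of_twinMatching {ι κ₁ κ₂ : Type*} [Fintype ι] [DecidableEq ι]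
    [Fintype κ₁] [DecidableEq κ₁] [Fintype κ₂] [DecidableEq κ₂]
    (u w : ι → Finset (Fin h)) (a c : Fin h) (erow ecol : κ₁ ⊕ κ₂ ≃ ι) (c₁ c₂ : κ₂ → κ₁)
    (hr₁ : ∀ k, a ∉ u (erow (Sum.inl (c₁ k)))) (hr₂ : ∀ k, a ∈ u (erow (Sum.inr k)))
    (hr₃ : ∀ k, (u (erow (Sum.inr k))).erase a = (u (erow (Sum.inl (c₁ k)))).erase a)
    (hc₁ : ∀ k, c ∉ w (ecol (Sum.inl (c₂ k)))) (hc₂ : ∀ k, c ∈ w (ecol (Sum.inr k)))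
    (hc₃ : ∀ k, (w (ecol (Sum.inr k))).erase c = (w (ecol (Sum.inl (c₂ k)))).erase c)
    (g : MvPolynomial (Fin (h + h)) ℂ)
    (hg₁ : (Matrix.of fun k k' : κ₁ => MvPolynomial.coeff
        (∑ a' ∈ (u (erow (Sum.inl k))).erase a, Finsupp.single (Fin.castAdd h a') 1 +
          ∑ c' ∈ (w (ecol (Sum.inl k'))).erase c, Finsupp.single (Fin.natAdd h c') 1) g).det ≠ 0)
    (hg₂ : (Matrix.of fun k k' : κ₂ => MvPolynomial.coeff
        (∑ a' ∈ (u (erow (Sum.inr k))).erase a, Finsupp.single (Fin.castAdd h a') 1 +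
          ∑ c' ∈ (w (ecol (Sum.inr k'))).erase c, Finsupp.single (Fin.natAdd h c') 1) g).det ≠ 0) :
    ∃ f : MvPolynomial (Fin (h + h)) ℂ, complexity f ≤ complexity g + 7 ∧
      f.totalDegree ≤ g.totalDegree + 2 ∧
      (Matrix.of fun i j : ι => MvPolynomial.coeff
        (∑ a' ∈ u i, Finsupp.single (Fin.castAdd h a') 1 +
          ∑ c' ∈ w j, Finsupp.single (Fin.natAdd h c') 1) f).det ≠ 0 := by
  classical
  -- the engine, with entry function the contracted coefficients of `g`
  obtain ⟨μ, hμ⟩ := exists_det_twinGadget_ne_zero (κ₁ := κ₁) (κ₂ := κ₂)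
    (fun ρ ρ' : Finset (Fin h) => MvPolynomial.coeff
      (∑ a' ∈ ρ, Finsupp.single (Fin.castAdd h a') 1 + ∑ c' ∈ ρ', Finsupp.single (Fin.natAdd h c') 1 :
        Fin (h + h) →₀ ℕ) g)
    (fun i => (u i).erase a) (fun j => (w j).erase c) (fun i => a ∈ u i) (fun j => c ∈ w j)
    erow ecol c₁ c₂ hr₁ hr₂ hr₃ hc₁ hc₂ hc₃ hg₁ hg₂
  set xa : Fin (h + h) := Fin.castAdd h a with hxa
  set yc : Fin (h + h) := Fin.natAdd h c with hyc
  set g₀ : MvPolynomial (Fin (h + h)) ℂ := ∑ d ∈ g.support with (d xa = 0 ∧ d yc = 0),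
      MvPolynomial.monomial d (MvPolynomial.coeff d g) with hg₀
  set G : MvPolynomial (Fin (h + h)) ℂ := (1 + MvPolynomial.X xa) * (1 + MvPolynomial.X yc) +
      MvPolynomial.C μ * (MvPolynomial.X xa * MvPolynomial.X yc) with hG
  refine ⟨g₀ * G, ?_, ?_, ?_⟩
  · -- size
    have hX : ∀ s : Fin (h + h), complexity (1 + MvPolynomial.X s : MvPolynomial (Fin (h + h)) ℂ) ≤ 1 :=
      fun s => by
        calc _ ≤ complexity (1 : MvPolynomial (Fin (h + h)) ℂ) +
              complexity (MvPolynomial.X s : MvPolynomial (Fin (h + h)) ℂ) + 1 :=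
              complexity_add_le_holds _ _
          _ = 1 := by rw [← MvPolynomial.C_1, complexity_C_holds, complexity_X_holds]
    have hG6 : complexity G ≤ 6 := by
      calc complexity G ≤ complexity ((1 + MvPolynomial.X xa) * (1 + MvPolynomial.X yc)) +
            complexity (MvPolynomial.C μ * (MvPolynomial.X xa * MvPolynomial.X yc)) + 1 :=
            complexity_add_le_holds _ _
        _ ≤ (complexity (1 + MvPolynomial.X xa : MvPolynomial (Fin (h + h)) ℂ) +
              complexity (1 + MvPolynomial.X yc : MvPolynomial (Fin (h + h)) ℂ) + 1) +
            (complexity (MvPolynomial.C μ : MvPolynomial (Fin (h + h)) ℂ) +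
              complexity (MvPolynomial.X xa * MvPolynomial.X yc) + 1) + 1 := by
            gcongr
            · exact complexity_mul_le_holds _ _
            · exact complexity_mul_le_holds _ _
        _ ≤ (1 + 1 + 1) + (0 + (complexity (MvPolynomial.X xa : MvPolynomial (Fin (h + h)) ℂ) +
              complexity (MvPolynomial.X yc : MvPolynomial (Fin (h + h)) ℂ) + 1) + 1) + 1 := by
            gcongr
            · exact hX xa
            · exact hX yc
            · exact (complexity_C_holds _).le
            · exact complexity_mul_le_holds _ _
        _ = 6 := by rw [complexity_X_holds, complexity_X_holds]
    calc complexity (g₀ * G) ≤ complexity g₀ + complexity G + 1 := complexity_mul_le_holds _ _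
      _ ≤ complexity g + 6 + 1 := by
          gcongr
          exact complexity_killVars_le xa yc g
      _ = complexity g + 7 := by ring
  · -- degree
    have hX : ∀ s : Fin (h + h), (1 + MvPolynomial.X s : MvPolynomial (Fin (h + h)) ℂ).totalDegree ≤ 1 :=
      fun s => (MvPolynomial.totalDegree_add _ _).trans (max_le (by simp) (by
        rw [MvPolynomial.totalDegree_X]))
    have hG2 : G.totalDegree ≤ 2 := by
      refine (MvPolynomial.totalDegree_add _ _).trans (max_le ?_ ?_)
      · exact (MvPolynomial.totalDegree_mul _ _).trans (add_le_add (hX xa) (hX yc))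
      · refine (MvPolynomial.totalDegree_mul _ _).trans ?_
        rw [MvPolynomial.totalDegree_C, zero_add]
        refine (MvPolynomial.totalDegree_mul _ _).trans ?_
        rw [MvPolynomial.totalDegree_X, MvPolynomial.totalDegree_X]
    calc (g₀ * G).totalDegree ≤ g₀.totalDegree + G.totalDegree := MvPolynomial.totalDegree_mul _ _
      _ ≤ g.totalDegree + 2 := add_le_add (totalDegree_killVars_le xa yc g) hG2
  · -- the matrix
    have hM : (Matrix.of fun i j : ι => MvPolynomial.coeff
        (∑ a' ∈ u i, Finsupp.single (Fin.castAdd h a') 1 +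
          ∑ c' ∈ w j, Finsupp.single (Fin.natAdd h c') 1) (g₀ * G)) =
        Matrix.of fun i j : ι => MvPolynomial.coeff
          (∑ a' ∈ (u i).erase a, Finsupp.single (Fin.castAdd h a') 1 +
            ∑ c' ∈ (w j).erase c, Finsupp.single (Fin.natAdd h c') 1 : Fin (h + h) →₀ ℕ) g *
          (if a ∈ u i ∧ c ∈ w j then 1 + μ else 1) := by
      ext i j
      rw [Matrix.of_apply, Matrix.of_apply, hg₀, hG, hxa, hyc, coeff_twinGadget, mul_comm]
    rw [hM]
    exact hμ

end Summit.ValiantsHypothesis.ValiantsHypothesis.Theorems.BarrierLever.TwinMatching
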